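import Summits.ResolutionOfSingularities.ResolutionOfSingularities.Theses.WildQuotients
import Summits.ResolutionOfSingularities.ResolutionOfSingularities.Theorems.PAlterationAssembly
import Summits.ResolutionOfSingularities.ResolutionOfSingularities.Theorems.PAlterationPalterationThesisPialtOfPerfect
import Summits.ResolutionOfSingularities.ResolutionOfSingularities.Theorems.PAlterationPialtNormalProjective
import Summits.ResolutionOfSingularities.ResolutionOfSingularities.Theorems.WildQuotientsGaloisQuotientAlteration
import Summits.ResolutionOfSingularities.ResolutionOfSingularities.Theorems.WildQuotientsSummitReductionStubPairTransport
import Summits.ResolutionOfSingularities.ResolutionOfSingularities.Theorems.WildQuotientsSummitReductionStubPairDimZero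
import Summits.ResolutionOfSingularities.ResolutionOfSingularities.Theorems.WildQuotientsSummitReductionSemiStablePairLemmas
import Summits.ResolutionOfSingularities.ResolutionOfSingularities.Theorems.WildQuotientsSummitReductionStubPairEquivariantFibration
import Summits.ResolutionOfSingularities.ResolutionOfSingularities.Theorems.WildQuotientsSummitReductionStubPairCanonicalStrictification
import Summits.ResolutionOfSingularities.ResolutionOfSingularities.Theorems.WildQuotientsSummitReductionStubPairRegularBaseChangeReduction
import Summits.ResolutionOfSingularities.ResolutionOfSingularities.Theorems.WildQuotientsSummitReductionStubPairSsCodimThreeAssembly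
import Summits.ResolutionOfSingularities.ResolutionOfSingularities.Theorems.WildQuotientsSummitReductionStubPairNodeThickness
import Summits.ResolutionOfSingularities.ResolutionOfSingularities.Theorems.WildQuotientsSummitReductionStubPairOrbitBlowupClaimOfCentre
import Summits.ResolutionOfSingularities.ResolutionOfSingularities.Theorems.WildQuotientsSummitReductionStubPairSsOrbitBlowup7Reduction
import Summits.ResolutionOfSingularities.ResolutionOfSingularities.Theorems.WildQuotientsSummitReductionStubPairQuasiSplitBaseChange
import Summits.ResolutionOfSingularities.ResolutionOfSingularities.Theorems.WildQuotientsSummitReductionStubPairOrbitBlowupCentreFlat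
import Summits.ResolutionOfSingularities.ResolutionOfSingularities.Theorems.WildQuotientsSummitReductionStubPairOrbitBlowupCentreNew
import Summits.ResolutionOfSingularities.ResolutionOfSingularities.Theorems.WildQuotientsSummitReductionStubPairQuasiSplitNormalForm
import Summits.ResolutionOfSingularities.ResolutionOfSingularities.Theorems.WildQuotientsSummitReductionStubPairOrbitNormalFormBlowupReduction
import Summits.ResolutionOfSingularities.ResolutionOfSingularities.Theorems.WildQuotientsSummitReductionStubPairOrbitNormalFormBlowupSingularOverCentre
import Summits.ResolutionOfSingularities.ResolutionOfSingularities.Theorems.WildQuotientsSummitReductionStubPairOrbitNormalFormBlowupStrictTransformRegular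
import Summits.ResolutionOfSingularities.ResolutionOfSingularities.Theorems.WildQuotientsSummitReductionStubPairEquivariantSemiStableReductionOfDeJong59
import Summits.ResolutionOfSingularities.ResolutionOfSingularities.Theorems.WildQuotientsSummitReductionStubPairOrbitBlowupCentreLocal
import Summits.ResolutionOfSingularities.ResolutionOfSingularities.Theorems.WildQuotientsSummitReductionStubPairOrbitNormalFormBlowupModelSingularOverCentre
import Summits.ResolutionOfSingularities.ResolutionOfSingularities.Theorems.WildQuotientsSummitReductionStubPairOrbitNormalFormBlowupChartsOverCentreReduction2
import Summits.ResolutionOfSingularities.ResolutionOfSingularities.Theorems.WildQuotientsSummitReductionStubPairOrbitNormalFormBlowupModelChartsOverCentre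
import Literature.AlgebraicGeometry.Resolution.AlterationsSemiStable
import Literature.AlgebraicGeometry.Resolution.QuasiSplitSemiStableCurveFibrations
import Literature.AlgebraicGeometry.Resolution.AlterationsSemiStableResolution
import Literature.AlgebraicGeometry.Resolution.StrictNormalCrossings
import Literature.AlgebraicGeometry.Motives.SymmetricPowerProjective
import Mathlib.AlgebraicGeometry.Geometrically.Irreducible
import HarnessLib

/-!
# Crux `WildQuotients.SummitReduction` (stmt-ResolutionOfSingularities-16324) — line `FramePerfect`,
# CLOSED MODULO ONE NAMED FACT: `SummitReduction` from de Jong 1997, Thm. 5.9 (relative dimension 1)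
# (part 1/6 — 1b from the named fact (h59) by the landed GLUE, and 1c the pull-back to the resolved base (de Jong 1997, 5.4, Thm. 5.9))

Route `ResolutionOfSingularities/WildQuotients`, crux `SummitReduction` (stmt-ResolutionOfSingularities-16324):
one part of the line skeleton `Cruxes/SummitReduction/Lines/FramePerfect.lean` (v12, lead prover c4) with its
one remaining stub — the Literature NAMED FACT `DeJong1997_quasiSplitSemiStableCurveFibration` (de Jong
1997, Thm. 5.9 in relative dimension 1) — turned into the hypothesis `h59`; the story, the map of the ~115
landed helper files and the conditional crux `summitReduction_of_deJong1997Theorem59` are in the last part,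
`WildQuotientsSummitReductionOfDeJong1997Theorem59.lean`. [cite: DeJong1997, Thm. 5.9, Prop. 5.11, Thm. 5.13, pp. 613–620]
[cite: DeJong1996, 3.2–3.5, 4.23–4.28, 7.1–7.3, pp. 62–65, 75–76, 87–88]
-/

set_option linter.dupNamespace false

noncomputable section

open CategoryTheory CategoryTheory.Limits AlgebraicGeometry TopologicalSpace
open Literature.AlgebraicGeometry.Resolution Literature.AlgebraicGeometry.RelativeSpec
open Literature.AlgebraicGeometry.Motives (RatFn.functionFieldMap RatFn.functionFieldMap_comp)
open Literature.AlgebraicGeometry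

namespace Summit.ResolutionOfSingularities.ResolutionOfSingularities.Theorems

/-! ## Stub 1b (XL): equivariant quasi-split semi-stable reduction of the fibration over a Galois
alteration of the base (de Jong 1997, Thm. 2.4 + Rem. 2.5 + Lemma 5.7) -/


-- GLUE LANDED (p151258): `stub_pair_equivariantSemiStableReduction_of_deJong59` is imported from
-- `…StubPairEquivariantSemiStableReductionOfDeJong59`.


-- 1b = the landed GLUE `stub_pair_equivariantSemiStableReduction_of_deJong59 h59` (p151258), used directly below.

/-! ## QS LANDED (p144476): quasi-splitness is stable under base change -/

-- QS LANDED (p144476): `stub_pair_quasiSplitBaseChange` is imported from `…StubPairQuasiSplitBaseChange`.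

/-! ## 1c, proved modulo stub QS: pull-back to the regular base (de Jong 1997, 5.4; landed
reduction p137317 re-run with the projectivity of the new base recorded) -/

/-- **Base change of the `G₁`-semi-stable model along the regular Galois alteration of the base**
(de Jong 1997, 5.4 and the step "(5.12.1) for the base" in the proof of Thm. 5.13) — the 1c worker's
`stub_pair_regularBaseChange_of_quasiSplitBaseChange` (p137317: the pull-back `X₁ ×_{Y₁} Y₂`, the
group `G' = {(g₂, g₁) | ρ₂ g₂ ≫ ψ₂ = ψ₂ ≫ ρY₁ g₁}` ⊇ graph of `φ₂`, satisfying (5.4.1), the compositum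
`K(X₁ ×_{Y₁} Y₂) = K(X₁) · K(Y₂)` and the purely inseparable clause `galois_clause_pullback`), with
its hypothesis `hQS` supplied by `stub_pair_quasiSplitBaseChange` and ONE MORE CONJUNCT in the
conclusion: the new base `Y' = Y₂` is projective over `k` (it is, by the induction hypothesis).
Proof copied from the landed file with `hproj₂` recorded. [cite: DeJong1997, 5.4 and proof of Thm. 5.13, pp. 613, 620] -/
theorem pair_regularBaseChange (k : Type) [Field k]
    (X : Scheme.{0}) [IsIntegral X] (f : X ⟶ Spec (.of k))
    (G : Type) [Group G] [Finite G] (ρ : G →* Aut X) (Z : Set X)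
    (G₁ : Type) [Group G₁] [Finite G₁] (X₁ Y₁ : Scheme.{0}) [IsIntegral X₁] [IsIntegral Y₁]
    (f₁ : X₁ ⟶ Y₁) (q₁ : Y₁ ⟶ Spec (.of k)) (ρX₁ : G₁ →* Aut X₁) (ρY₁ : G₁ →* Aut Y₁)
    (D₁ : Set Y₁) (hD₁ : IsClosed D₁) (m : ℕ) (σ : Fin m → (Y₁ ⟶ X₁))
    (hprojX₁ : Motives.IsProjectiveOver (Over.mk (f₁ ≫ q₁)))
    (hss₁ : IsSemiStableCurve f₁)
    (hqs₁ : (∀ x : X₁, (¬ ∃ U : X₁.Opens, x ∈ U ∧ Smooth (U.ι ≫ f₁)) →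
        ∃ e : AdicCompletion
            ((IsLocalRing.maximalIdeal (X₁.presheaf.stalk x)).map (Ideal.Quotient.mk
              ((IsLocalRing.maximalIdeal (Y₁.presheaf.stalk (f₁.base x))).map (f₁.stalkMap x).hom)))
            (X₁.presheaf.stalk x ⧸
              (IsLocalRing.maximalIdeal (Y₁.presheaf.stalk (f₁.base x))).map (f₁.stalkMap x).hom) ≃+*
          MvPowerSeries (Fin 2) (Y₁.presheaf.stalk (f₁.base x) ⧸ IsLocalRing.maximalIdeal (Y₁.presheaf.stalk (f₁.base x))) ⧸
            Ideal.span {(MvPowerSeries.X 0 * MvPowerSeries.X 1 :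
              MvPowerSeries (Fin 2) (Y₁.presheaf.stalk (f₁.base x) ⧸ IsLocalRing.maximalIdeal (Y₁.presheaf.stalk (f₁.base x))))},
          e.toRingHom.comp ((algebraMap (X₁.presheaf.stalk x ⧸
              (IsLocalRing.maximalIdeal (Y₁.presheaf.stalk (f₁.base x))).map (f₁.stalkMap x).hom) _).comp
            (Ideal.quotientMap ((IsLocalRing.maximalIdeal (Y₁.presheaf.stalk (f₁.base x))).map (f₁.stalkMap x).hom)
              (f₁.stalkMap x).hom Ideal.le_comap_map)) =
          algebraMap (Y₁.presheaf.stalk (f₁.base x) ⧸ IsLocalRing.maximalIdeal (Y₁.presheaf.stalk (f₁.base x))) _))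
    (hsm₁ : Smooth (f₁ ∣_ ⟨D₁ᶜ, hD₁.isOpen_compl⟩))
    (_hgi₁ : GeometricallyIrreducible (f₁.fiberToSpecResidueField (genericPoint Y₁)))
    (hσf : (∀ i : Fin m, σ i ≫ f₁ = 𝟙 Y₁))
    (hσdisj : (Pairwise fun i j : Fin m => Disjoint (Set.range (σ i)) (Set.range (σ j))))
    (hσsm : (∀ i : Fin m, ∃ U : X₁.Opens, Set.range (σ i) ⊆ (U : Set X₁) ∧ Smooth (U.ι ≫ f₁)))
    (hf₁G : (∀ g : G₁, (ρX₁ g).hom ≫ f₁ = f₁ ≫ (ρY₁ g).hom))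
    (hσG : (∀ (g : G₁) (i : Fin m), ∃ j : Fin m, σ i ≫ (ρX₁ g).hom = (ρY₁ g).hom ≫ σ j))
    (φ₁ : G₁ →* G) (π₁ : X₁ ⟶ X) [IsDominant π₁]
    (hφsurj : Function.Surjective φ₁)
    (hπalt : IsAlteration π₁)
    (hπcomm : f₁ ≫ q₁ = π₁ ≫ f)
    (hπG : (∀ g : G₁, (ρX₁ g).hom ≫ π₁ = π₁ ≫ (ρ (φ₁ g)).hom))
    (hgal : (∀ a : X₁.functionField, (∀ g : G₁, RatFn.functionFieldMap (ρX₁ g).hom a = a) →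
        ∃ (n : ℕ) (c : X.functionField), (∀ g : G, RatFn.functionFieldMap (ρ g).hom c = c) ∧
          a ^ ringExpChar X.functionField ^ n = RatFn.functionFieldMap π₁ c))
    (hZbd : π₁.base ⁻¹' Z ⊆ DeJong1996.semiStableBoundary f₁ D₁ σ)
    (hbase : ∃ (G₂ : Type) (_ : Group G₂) (_ : Finite G₂) (X₂ : Scheme.{0}) (_ : IsIntegral X₂)
        (ρ₂ : G₂ →* Aut X₂) (φ₂ : G₂ →* G₁) (π₂ : X₂ ⟶ Y₁) (_ : IsDominant π₂),
        Function.Surjective φ₂ ∧ IsAlteration π₂ ∧ Scheme.IsRegular X₂ ∧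
        Motives.IsProjectiveOver (Over.mk (π₂ ≫ q₁)) ∧
        (∀ g : G₂, (ρ₂ g).hom ≫ π₂ = π₂ ≫ (ρY₁ (φ₂ g)).hom) ∧
        (∀ a : X₂.functionField, (∀ g : G₂, RatFn.functionFieldMap (ρ₂ g).hom a = a) →
          ∃ (n : ℕ) (c : Y₁.functionField), (∀ g : G₁, RatFn.functionFieldMap (ρY₁ g).hom c = c) ∧
            a ^ ringExpChar Y₁.functionField ^ n = RatFn.functionFieldMap π₂ c) ∧
        ∃ D₂ : Set X₂, IsStrictNormalCrossingsDivisor X₂ D₂ ∧ π₂.base ⁻¹' (D₁) ⊆ D₂ ∧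
          (∀ g : G₂, (ρ₂ g).hom.base '' D₂ = D₂) ∧
          (∀ (g : G₂) (C : Set X₂), Maximal (fun C : Set X₂ => IsIrreducible C ∧ C ⊆ D₂) C →
            (C ∩ (ρ₂ g).hom.base '' C).Nonempty → (ρ₂ g).hom.base '' C = C)) :
    ∃ (G' : Type) (_ : Group G') (_ : Finite G') (X' Y' : Scheme.{0}) (_ : IsIntegral X')
      (_ : IsIntegral Y') (f' : X' ⟶ Y') (q' : Y' ⟶ Spec (.of k)) (ρX' : G' →* Aut X')
      (ρY' : G' →* Aut Y') (D' : Set Y') (hD' : IsStrictNormalCrossingsDivisor Y' D') (m : ℕ)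
      (τ : Fin m → (Y' ⟶ X')),
      Motives.IsProjectiveOver (Over.mk (f' ≫ q')) ∧
      Motives.IsProjectiveOver (Over.mk q') ∧
      Scheme.IsRegular Y' ∧
      (∀ g : G', (ρY' g).hom.base '' D' = D') ∧
      (∀ (g : G') (C : Set Y'), Maximal (fun C : Set Y' => IsIrreducible C ∧ C ⊆ D') C →
        (C ∩ (ρY' g).hom.base '' C).Nonempty → (ρY' g).hom.base '' C = C) ∧
      IsSemiStableCurve f' ∧
      (∀ x : X', (¬ ∃ U : X'.Opens, x ∈ U ∧ Smooth (U.ι ≫ f')) →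
        ∃ e : AdicCompletion
            ((IsLocalRing.maximalIdeal (X'.presheaf.stalk x)).map (Ideal.Quotient.mk
              ((IsLocalRing.maximalIdeal (Y'.presheaf.stalk (f'.base x))).map (f'.stalkMap x).hom)))
            (X'.presheaf.stalk x ⧸
              (IsLocalRing.maximalIdeal (Y'.presheaf.stalk (f'.base x))).map (f'.stalkMap x).hom) ≃+*
          MvPowerSeries (Fin 2) (Y'.presheaf.stalk (f'.base x) ⧸ IsLocalRing.maximalIdeal (Y'.presheaf.stalk (f'.base x))) ⧸
            Ideal.span {(MvPowerSeries.X 0 * MvPowerSeries.X 1 :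
              MvPowerSeries (Fin 2) (Y'.presheaf.stalk (f'.base x) ⧸ IsLocalRing.maximalIdeal (Y'.presheaf.stalk (f'.base x))))},
          e.toRingHom.comp ((algebraMap (X'.presheaf.stalk x ⧸
              (IsLocalRing.maximalIdeal (Y'.presheaf.stalk (f'.base x))).map (f'.stalkMap x).hom) _).comp
            (Ideal.quotientMap ((IsLocalRing.maximalIdeal (Y'.presheaf.stalk (f'.base x))).map (f'.stalkMap x).hom)
              (f'.stalkMap x).hom Ideal.le_comap_map)) =
          algebraMap (Y'.presheaf.stalk (f'.base x) ⧸ IsLocalRing.maximalIdeal (Y'.presheaf.stalk (f'.base x))) _) ∧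
      Smooth (f' ∣_ ⟨D'ᶜ, hD'.isClosed.isOpen_compl⟩) ∧
      (∀ i : Fin m, τ i ≫ f' = 𝟙 Y') ∧
      (Pairwise fun i j : Fin m => Disjoint (Set.range (τ i)) (Set.range (τ j))) ∧
      (∀ i : Fin m, ∃ U : X'.Opens, Set.range (τ i) ⊆ (U : Set X') ∧ Smooth (U.ι ≫ f')) ∧
      (∀ g : G', (ρX' g).hom ≫ f' = f' ≫ (ρY' g).hom) ∧
      (∀ (g : G') (i : Fin m), ∃ j : Fin m, τ i ≫ (ρX' g).hom = (ρY' g).hom ≫ τ j) ∧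
      ∃ (φ' : G' →* G) (π' : X' ⟶ X) (_ : IsDominant π'),
        Function.Surjective φ' ∧ IsAlteration π' ∧ f' ≫ q' = π' ≫ f ∧
        (∀ g : G', (ρX' g).hom ≫ π' = π' ≫ (ρ (φ' g)).hom) ∧
        (∀ a : X'.functionField, (∀ g : G', RatFn.functionFieldMap (ρX' g).hom a = a) →
          ∃ (n : ℕ) (c : X.functionField), (∀ g : G, RatFn.functionFieldMap (ρ g).hom c = c) ∧
            a ^ ringExpChar X.functionField ^ n = RatFn.functionFieldMap π' c) ∧
        π'.base ⁻¹' Z ⊆ DeJong1996.semiStableBoundary f' D' τ := by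
  obtain ⟨G₂, _, _, Y₂, _, ρ₂, φ₂, ψ₂, _, hφ₂, hψ₂alt, hreg₂, hproj₂, hψ₂G, hgal₂, D₂, hD₂, hD₁D₂,
    hD₂stab, hD₂strict⟩ := hbase
  -- standing instances
  haveI := hss₁.flat
  haveI := hss₁.isProper
  haveI : Surjective f₁ := semiStableCurve_surjective hss₁
  haveI := hψ₂alt.isProper
  haveI : Surjective ψ₂ := hψ₂alt.surjective
  have hη : genericPoint Y₁ ∉ D₁ := genericPoint_notMem_of_preimage_subset_sncd ψ₂ hD₂ hD₁D₂
  haveI : IsIntegral (pullback f₁ ψ₂) :=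
    isIntegral_pullback_of_isSemiStableCurve hss₁ hD₁ hsm₁ hη ψ₂
  haveI : IsProper (f₁ ≫ q₁) := Motives.IsProjectiveOver.isProper (X := Over.mk (f₁ ≫ q₁)) hprojX₁
  haveI : IsSeparated (f₁ ≫ q₁) := inferInstance
  haveI : X₁.IsSeparated := (HasAffineProperty.iff_of_isAffine (P := @IsSeparated)).mp ‹_›
  haveI : Y₁.IsSeparated := isSeparated_base_of_isSemiStableCurve hss₁
  haveI : IsProper (ψ₂ ≫ q₁) := Motives.IsProjectiveOver.isProper (X := Over.mk (ψ₂ ≫ q₁)) hproj₂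
  haveI : IsLocallyNoetherian X₁ := LocallyOfFiniteType.isLocallyNoetherian (f₁ ≫ q₁)
  haveI : IsLocallyNoetherian Y₂ := LocallyOfFiniteType.isLocallyNoetherian (ψ₂ ≫ q₁)
  -- the group `G' = {(g₂, g₁) | ρ₂ g₂ covers ρY₁ g₁ along ψ₂}` (it contains the graph of `φ₂` and,
  -- by the rigidity of `ψ₂`, every `(g₂, 1)` with `g₂` acting trivially on `K(Y₁)`: (5.4.1))
  let G' : Subgroup (G₂ × G₁) :=
    { carrier := {g | (ρ₂ g.1).hom ≫ ψ₂ = ψ₂ ≫ (ρY₁ g.2).hom}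
      mul_mem' := fun {a b} ha hb => by
        simp only [Set.mem_setOf_eq, Prod.fst_mul, Prod.snd_mul, map_mul, Aut.Aut_mul_def,
          Iso.trans_hom, Category.assoc] at ha hb ⊢
        rw [ha, reassoc_of% hb]
      one_mem' := by
        simp only [Set.mem_setOf_eq, Prod.fst_one, Prod.snd_one, map_one]
        show 𝟙 _ ≫ ψ₂ = ψ₂ ≫ 𝟙 _
        simp
      inv_mem' := fun {a} ha => by
        simp only [Set.mem_setOf_eq, Prod.fst_inv, Prod.snd_inv, map_inv, Aut.Aut_inv_def,
          Iso.symm_hom] at ha ⊢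
        rw [Iso.inv_comp_eq, ← Category.assoc, ha, Category.assoc, Iso.hom_inv_id,
          Category.comp_id] }
  let pr₁ : G' →* G₂ := (MonoidHom.fst G₂ G₁).comp G'.subtype
  let pr₂ : G' →* G₁ := (MonoidHom.snd G₂ G₁).comp G'.subtype
  -- the action of `G'` on `P = X₁ ×_{Y₁} Y₂`
  let θ : G' → (pullback f₁ ψ₂ ⟶ pullback f₁ ψ₂) := fun g =>
    pullback.map f₁ ψ₂ f₁ ψ₂ (ρX₁ g.1.2).hom (ρ₂ g.1.1).hom (ρY₁ g.1.2).hom (hf₁G g.1.2).symm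
      (show (ρ₂ g.1.1).hom ≫ ψ₂ = ψ₂ ≫ (ρY₁ g.1.2).hom from g.2).symm
  have θfst : ∀ g, θ g ≫ pullback.fst f₁ ψ₂ = pullback.fst f₁ ψ₂ ≫ (ρX₁ g.1.2).hom :=
    fun g => pullback.lift_fst _ _ _
  have θsnd : ∀ g, θ g ≫ pullback.snd f₁ ψ₂ = pullback.snd f₁ ψ₂ ≫ (ρ₂ g.1.1).hom :=
    fun g => pullback.lift_snd _ _ _
  have θone : θ 1 = 𝟙 _ := by
    apply pullback.hom_ext
    · rw [θfst, Category.id_comp]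
      show _ ≫ (ρX₁ 1).hom = _
      rw [map_one]
      exact Category.comp_id _
    · rw [θsnd, Category.id_comp]
      show _ ≫ (ρ₂ 1).hom = _
      rw [map_one]
      exact Category.comp_id _
  have θmul : ∀ g h, θ (g * h) = θ h ≫ θ g := fun g h => by
    apply pullback.hom_ext
    · rw [θfst, Category.assoc, θfst, reassoc_of% (θfst h)]
      show _ ≫ (ρX₁ (g.1.2 * h.1.2)).hom = _
      rw [map_mul, Aut.Aut_mul_def, Iso.trans_hom]
    · rw [θsnd, Category.assoc, θsnd, reassoc_of% (θsnd h)]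
      show _ ≫ (ρ₂ (g.1.1 * h.1.1)).hom = _
      rw [map_mul, Aut.Aut_mul_def, Iso.trans_hom]
  let ρP : G' →* Aut (pullback f₁ ψ₂) :=
    { toFun := fun g => ⟨θ g, θ g⁻¹, by rw [← θmul, inv_mul_cancel, θone],
        by rw [← θmul, mul_inv_cancel, θone]⟩
      map_one' := Iso.ext θone
      map_mul' := fun g h => Iso.ext (by rw [Aut.Aut_mul_def, Iso.trans_hom]; exact θmul g h) }
  have hρP : ∀ g, (ρP g).hom = θ g := fun g => rfl
  have hρP₁ : ∀ g, (ρP g).hom ≫ pullback.fst f₁ ψ₂ = pullback.fst f₁ ψ₂ ≫ (ρX₁ (pr₂ g)).hom :=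
    fun g => θfst g
  have hρP₂ : ∀ g, (ρP g).hom ≫ pullback.snd f₁ ψ₂ = pullback.snd f₁ ψ₂ ≫ (ρ₂ (pr₁ g)).hom :=
    fun g => θsnd g
  have hlift : Function.Surjective pr₂ := fun g₁ => by
    obtain ⟨g₂, rfl⟩ := hφ₂ g₁
    exact ⟨⟨(g₂, φ₂ g₂), hψ₂G g₂⟩, rfl⟩
  have hker : ∀ g₂ : G₂, (ρ₂ g₂).hom ≫ ψ₂ = ψ₂ → ∃ g : G', pr₁ g = g₂ ∧ pr₂ g = 1 := fun g₂ h =>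
    ⟨⟨(g₂, 1), by
      show (ρ₂ g₂).hom ≫ ψ₂ = ψ₂ ≫ (ρY₁ 1).hom
      rw [map_one, h]
      exact (Category.comp_id _).symm⟩, rfl, rfl⟩
  haveI : Finite G' := inferInstance
  refine ⟨G', inferInstance, inferInstance, pullback f₁ ψ₂, Y₂, inferInstance, inferInstance,
    pullback.snd f₁ ψ₂, ψ₂ ≫ q₁, ρP, ρ₂.comp pr₁, D₂, hD₂, m,
    DeJong1996.PreSemiStablePair.pullbackSection hσf ψ₂,
    isProjectiveOver_pullback_of_isSemiStableCurve hss₁ q₁ hprojX₁ ψ₂ hproj₂, hproj₂, hreg₂,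
    fun g => hD₂stab (pr₁ g), fun g C hC hne => hD₂strict (pr₁ g) C hC hne, hss₁.baseChange ψ₂,
    stub_pair_quasiSplitBaseChange f₁ ψ₂ hss₁ hqs₁, smooth_pullback_snd_morphismRestrict hD₁ hsm₁ ψ₂ hD₂.isClosed hD₁D₂,
    fun i => DeJong1996.PreSemiStablePair.pullbackSection_snd hσf ψ₂ i,
    pairwise_disjoint_pullbackSection hσf hσdisj ψ₂, exists_smooth_pullbackSection hσf hσsm ψ₂,
    fun g => hρP₂ g, fun g i => ?_, φ₁.comp pr₂, pullback.fst f₁ ψ₂ ≫ π₁, inferInstance,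
    hφsurj.comp hlift, (isAlteration_pullback_fst_of_isSemiStableCurve hss₁ hψ₂alt).comp hπalt,
    ?_, fun g => ?_, ?_, fun x hx => ?_⟩
  · -- the sections are permuted
    obtain ⟨j, hj⟩ := hσG g.1.2 i
    exact ⟨j, pullbackSection_comp_eq hσf ψ₂ (hρP₁ g) (hρP₂ g) g.2 hj⟩
  · -- `f₂ ≫ ψ₂ ≫ q₁ = (fst ≫ π₁) ≫ f`
    rw [Category.assoc, ← hπcomm, ← pullback.condition_assoc]
  · -- equivariance of `fst ≫ π₁`
    rw [← Category.assoc, hρP₁ g, Category.assoc, hπG (pr₂ g), Category.assoc]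
    rfl
  · -- the purely inseparable clause (de Jong 1997, 5.4)
    exact galois_clause_pullback ρ f₁ ρX₁ ρY₁ π₁ hgal ρ₂ φ₂ ψ₂ hψ₂G hgal₂ (functionFieldMap_fieldRange_sup_eq_top f₁ ψ₂)
      pr₁ pr₂ ρP hρP₁ hρP₂ hlift hker
  · -- the boundary
    exact preimage_fst_semiStableBoundary_subset hσf ψ₂ hD₁D₂ (hZbd hx)

end Summit.ResolutionOfSingularities.ResolutionOfSingularities.Theorems

end
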